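import Summits.Ventures.Crystal3D.Theorems.StickyWulffConstantGenericWallFloorStackWalkDefs
import HarnessLib

/-!
# The STACK WALK of the general-filling ledger: the walk invariant (definitions)

HONEST FRAMING. Part of the venture `Summits/Ventures/Crystal3D` (cell `crystal3d-full`), helper
`--supports` the crux `GenericWallFloor` (stmt-Ventures-19480) of `route-Ventures-StickyWulffConstant`,
registered line `WallLedgerG`, open stub `stub_twoSlabAdhesion` (general fillings).  Sequel of
`…StackWalkDefs` (the walk); this file DEFINES the invariant carried along the stack walk, proved in
`…StackWalk`:

* `WalkEntry.Sound z e` — a non-bottom level: direction slot, unit entry normal in menu position making the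
  direction positive, normal height `⟪m, z⟫ ≥ 1/7`, direction rise `≥ 3/8`, and `2√(2/3)·rise − ⟪m, z⟫ ≥ 1/7`
  (the height of the OTHER `{111}` normal through the direction, `…TwinNormals` / `…CapperRiseSharp`);
* `WalkEntry.Link e e′` — the upper frame is the twin of the lower across the upper entry normal, and the
  lower direction is positive for it (so POP is a capper step);
* `StackSound z stack` — bottom direction steep (`≥ √2/2`), all other levels sound and linked;
* `WalkCertified X y e` — the walker's predecessor `y − F v` carries the full `F`-shell or is an exact cap of
  which `y` is a capper: `y` owns the closed vertex star of `−v` (C12-55);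
* `WalkInv X z (y, stack)` — `y ∈ X`, sound stack, certified walker.

WHAT THIS IS NOT: definitions only; not the stub; F-C1 not moved.
-/

noncomputable section

namespace Summit.Ventures.Crystal3D.Theorems

open Finset
open scoped InnerProductSpace

/-- A NON-BOTTOM stack entry is sound for the vertical `z`: its direction is a slot, its entry normal is a
unit menu normal of its frame making the direction positive, the normal has height `≥ 1/7`, the direction
rises by `≥ 3/8`, and the second normal through the direction has height `≥ 1/7` too
(`2√(2/3)·rise − height ≥ 1/7`). -/
def WalkEntry.Sound (z : EuclideanSpace ℝ (Fin 3)) (e : WalkEntry) : Prop :=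
  e.dir ∈ fccSlots ∧ ‖e.nrm‖ = 1 ∧
  (∀ w ∈ fccSlots, ⟪e.frame w, e.nrm⟫_ℝ = 0 ∨ ⟪e.frame w, e.nrm⟫_ℝ = Real.sqrt (2 / 3) ∨
    ⟪e.frame w, e.nrm⟫_ℝ = -Real.sqrt (2 / 3)) ∧
  ⟪e.frame e.dir, e.nrm⟫_ℝ = Real.sqrt (2 / 3) ∧
  (1 / 7 : ℝ) ≤ ⟪e.nrm, z⟫_ℝ ∧ (3 / 8 : ℝ) ≤ ⟪e.frame e.dir, z⟫_ℝ ∧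
  (1 / 7 : ℝ) ≤ 2 * Real.sqrt (2 / 3) * ⟪e.frame e.dir, z⟫_ℝ - ⟪e.nrm, z⟫_ℝ

/-- Two consecutive stack entries are LINKED: the upper frame is the twin of the lower one across the upper
entry normal, and the lower direction is positive for that normal (this is what makes POP a capper step). -/
def WalkEntry.Link (e e' : WalkEntry) : Prop :=
  (∀ x, e.frame x = e'.frame x - (2 * ⟪e'.frame x, e.nrm⟫_ℝ) • e.nrm) ∧
  ⟪e'.frame e'.dir, e.nrm⟫_ℝ = Real.sqrt (2 / 3)

/-- A sound STACK: the bottom entry has a STEEP direction slot (`⟪F v, z⟫ ≥ √2/2`), every other entry is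
sound and linked to the one below. -/
def StackSound (z : EuclideanSpace ℝ (Fin 3)) : List WalkEntry → Prop
  | [] => False
  | [e] => e.dir ∈ fccSlots ∧ Real.sqrt 2 / 2 ≤ ⟪e.frame e.dir, z⟫_ℝ
  | e :: e' :: rest => e.Sound z ∧ e.Link e' ∧ StackSound z (e' :: rest)

/-- The walker at `y` with top entry `e` is CERTIFIED: its predecessor `y − F v` is in `X` and carries the
full `F`-shell, or is an exact cap seen in the frame `F` (every `F`-slot on the non-negative side of a unit
menu normal `n₀` occupied) of which `y` is a capper (`⟪F v, n₀⟫ > 0`).  Either way `y` owns the closed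
vertex star of `−v` (pattern C12-55). -/
def WalkCertified (X : Finset (EuclideanSpace ℝ (Fin 3))) (y : EuclideanSpace ℝ (Fin 3)) (e : WalkEntry) : Prop :=
  (y - e.frame e.dir ∈ X ∧ ∀ w ∈ fccSlots, y - e.frame e.dir + e.frame w ∈ X) ∨
  (∃ n₀ : EuclideanSpace ℝ (Fin 3), ‖n₀‖ = 1 ∧
    (∀ w ∈ fccSlots, ⟪e.frame w, n₀⟫_ℝ = 0 ∨ ⟪e.frame w, n₀⟫_ℝ = Real.sqrt (2 / 3) ∨
      ⟪e.frame w, n₀⟫_ℝ = -Real.sqrt (2 / 3)) ∧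
    0 < ⟪e.frame e.dir, n₀⟫_ℝ ∧ y - e.frame e.dir ∈ X ∧
    ∀ w ∈ fccSlots, 0 ≤ ⟪e.frame w, n₀⟫_ℝ → y - e.frame e.dir + e.frame w ∈ X)

/-- The WALK INVARIANT of a state `(y, stack)`: `y ∈ X`, the stack is sound, and the walker is certified by
its top entry. -/
def WalkInv (X : Finset (EuclideanSpace ℝ (Fin 3))) (z : EuclideanSpace ℝ (Fin 3))
    (s : EuclideanSpace ℝ (Fin 3) × List WalkEntry) : Prop :=
  s.1 ∈ X ∧ StackSound z s.2 ∧ ∃ e rest, s.2 = e :: rest ∧ WalkCertified X s.1 e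

/-! ### Unfolding -/

/-- A sound stack with two levels, unfolded. -/
@[simp] theorem stackSound_cons_cons (z : EuclideanSpace ℝ (Fin 3)) (e e' : WalkEntry) (rest : List WalkEntry) :
    StackSound z (e :: e' :: rest) ↔ e.Sound z ∧ e.Link e' ∧ StackSound z (e' :: rest) := Iff.rfl

/-- A sound stack with one level, unfolded. -/
@[simp] theorem stackSound_singleton (z : EuclideanSpace ℝ (Fin 3)) (e : WalkEntry) :
    StackSound z [e] ↔ e.dir ∈ fccSlots ∧ Real.sqrt 2 / 2 ≤ ⟪e.frame e.dir, z⟫_ℝ := Iff.rfl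

/-- The empty stack is not sound. -/
@[simp] theorem stackSound_nil (z : EuclideanSpace ℝ (Fin 3)) : ¬ StackSound z [] := fun h => h

/-- The top of a sound stack: its direction is a slot rising by at least `3/8`. -/
theorem StackSound.top (z : EuclideanSpace ℝ (Fin 3)) {e : WalkEntry} {rest : List WalkEntry}
    (h : StackSound z (e :: rest)) : e.dir ∈ fccSlots ∧ (3 / 8 : ℝ) ≤ ⟪e.frame e.dir, z⟫_ℝ := by
  cases rest with
  | nil =>
    obtain ⟨hd, hs⟩ := h
    refine ⟨hd, le_trans ?_ hs⟩
    have h2 : Real.sqrt 2 ^ 2 = 2 := Real.sq_sqrt (by norm_num)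
    nlinarith [Real.sqrt_nonneg 2, h2]
  | cons e' rest' =>
    obtain ⟨⟨hd, -, -, -, -, hr, -⟩, -, -⟩ := h
    exact ⟨hd, hr⟩

/-- The tail of a sound stack with two levels is sound. -/
theorem StackSound.tail (z : EuclideanSpace ℝ (Fin 3)) {e e' : WalkEntry} {rest : List WalkEntry}
    (h : StackSound z (e :: e' :: rest)) : StackSound z (e' :: rest) := h.2.2

end Summit.Ventures.Crystal3D.Theorems

end
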